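import Literature.NumberTheory.Automorphic.PairLFunctionPolesRankNeTwist
import Literature.NumberTheory.Automorphic.PairLFunctionPolesRankNeGodementJacquet
import Literature.NumberTheory.Automorphic.PairLFunctionBoundaryOneFamily
import HarnessLib

/-!
# Arthur–Clozel (2.2) off `s = 1` for `GL_n × GL_1` and `GL_1 × GL_n` from Godement–Jacquet and the
non-vanishing on the line (proofs only)

Topic `NumberTheory/Automorphic`; namespace `Literature.NumberTheory.Automorphic`. Proof file
(theorems only: no definition, no named fact, no instance) under the named fact
`JacquetShalika1981_partialPairL_boundary_of_ne_one` of `PairLFunctionPoles` — Arthur–Clozel,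
*Simple algebras, base change, and the advanced theory of the trace formula*, Ann. of Math.
Stud. 120 (1989), Ch. 3 §2, (2.2), p. 171 of the held copy, at the points `s₀ ≠ 1` of the line
`Re s = 1` — in the cases `m = 1` and `n = 1`, i.e. for the pairs `(π, χ)`, `(χ, π)` of a cuspidal `π`
of `GL_n(𝔸_K)` and an idele class character `χ` (a cuspidal automorphic representation of
`GL_1(𝔸_K)`). It is the companion at `s₀ = 1 + it`, `t ≠ 0`, of `PairLFunctionPolesRankNeTwist` and
`PairLFunctionPolesRankNeGodementJacquet` (the same pairs at `s₀ = 1`), whose reduction it runs at a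
general point of the line:

`L^S(s, π × χ) = L^S(s, π ⊗ χ)` is a partial *standard* `L`-function of the cuspidal twist `π ⊗ χ`
(`partialPairL_eq_partialStandardL_twist`, `IsSatakeFamilyOf.twistByChar`), so the one-family datum of
`PairLFunctionBoundaryOneFamily` at `s₀` is the **standard statement at `s₀`**: *for every cuspidal `Π`
of `GL_n(𝔸_K)`, every finite `S` and every Satake family `γ` of `Π` off `S`, `L^S(s, Π)` has a finite
non-zero limit as `s → s₀`, `Re s > 1`.* In print this is the holomorphy of `L(s, Π)` at `s₀`
(Godement–Jacquet, LNM 260 (1972), Thm. 13.8: entire for `n ≥ 2`; in the tree the named fact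
`godementJacquet` of `AutomorphicLFunctions`) with the non-vanishing **`L_S(1 + it, Π) ≠ 0`**
(Jacquet–Shalika, *A non-vanishing theorem for zeta functions of `GL_n`*, Invent. Math. 38 (1976),
Theorem p. 1 — for `GL_n × GL_1` this *is* the non-vanishing half of (2.2); not in the tree, an explicit
hypothesis here, D-0026). Jacquet–Shalika's (5.3.3) and (5.1.3), hypotheses of the sibling files, are
now the theorems `summable_normSq_trace_satakePow_holds`, `norm_satakeParameter_le_sqrt_holds`
(`SatakeParameterBoundHolds`), and the strict bound at `GL_1` is a theorem
(`norm_satakeParameter_lt_sqrt_of_le_two`), so nothing else is assumed.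

Contents (all proved):

* `standard_at_of_godementJacquet_of_nonvanishing` — **the standard statement at a point `s₀` of the
  line `re s = 1` (`n ≥ 2`) from `godementJacquet` and the non-vanishing of the boundary values at
  `s₀`** (`StandardLFunctionData.exists_tendsto_partialStandardL_of_hasEntireContinuation` at `s₀`,
  change of `S` by `exists_ne_zero_tendsto_partialStandardL_of_supset/subset`, the moved unramified
  factors `∏_a (1 - a q_v^{-s₀})` non-zero by (5.1.3));
* `exists_one_family_datum_of_standard_at`, `…_left` — the `GL_n × GL_1` / `GL_1 × GL_n` one-family
  datum at `s₀` from the standard statement at `s₀` (level of `χ`, `HeckeCharacter.exists_level`; the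
  twist `π ⊗ χ`);
* `JacquetShalika1981_partialPairL_boundary_of_ne_one_of_godementJacquet_of_nonvanishing` (**main**,
  `GL_n × GL_1`, `n ≥ 2`) and `…_left` (`GL_1 × GL_n`): **the named fact from `godementJacquet` at
  `GL_n` and the non-vanishing of `L^S(s, Π)` at the points `s₀ ≠ 1` of the line** (the one-family
  reductions `JacquetShalika1981_partialPairL_boundary_of_ne_one_of_one_family_of_le_two'` / `…_of_le_two`
  of `PairLFunctionBoundaryOneFamily`, the strict bound being needed at `GL_1` only).

`GL_1 × GL_1` (where `godementJacquet` does not apply to `Π = 1`) is `PairLFunctionPolesGLOneBoundaryProofs`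
(from Hecke's continuation) and, over `ℚ`, `JacquetShalika1981_partialPairL_boundary_of_ne_one_one_rat`.

## References

* J. Arthur, L. Clozel, *Simple algebras, base change, and the advanced theory of the trace
  formula*, Ann. of Math. Stud. 120 (1989), Ch. 3 §2, (2.2), p. 171 and p. 172. [ArthurClozelAMS120]
* R. Godement, H. Jacquet, *Zeta functions of simple algebras*, LNM 260 (1972), Thm. 13.8.
  [GodementJacquet1972]
* H. Jacquet, J. A. Shalika, *A non-vanishing theorem for zeta functions of `GL_n`*, Invent. Math. 38
  (1976), 1–16, Theorem p. 1. [JacquetShalikaInvent1976]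
* H. Jacquet, J. A. Shalika, *On Euler products and the classification of automorphic
  representations I*, Amer. J. Math. 103 (1981), Thm. (5.3), (5.1.3), Cor. (2.5). [JacquetShalikaAJM1981]
-/

noncomputable section

open scoped MatrixGroups Topology
open NumberField IsDedekindDomain MeasureTheory Filter Polynomial Complex

namespace Literature.NumberTheory.Automorphic

open AdelicGroupData

/-! ### The standard statement at a point of the line `re s = 1` -/

section StandardStatement

variable {n : ℕ} {K : Type} [Field K] [NumberField K]
  {μ : Measure (gl n K).automorphicQuotient} [(gl n K).IsAutomorphicMeasure μ]

/-- **The standard statement at a point of the line `re s = 1`, `n ≥ 2`, from Godement–Jacquet and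
the non-vanishing there.** Assume the named fact `godementJacquet` at `GL_n` (LNM 260, Thm. 13.8: for
cuspidal `Π` of `GL_n`, `n ≥ 2`, some standard `L`-function datum has entire `L(s, Π)`) and, at the point
`s₀` (`re s₀ = 1`), the **non-vanishing**: every boundary value `lim_{s → s₀, Re s > 1} L^S(s, Π)` of a
partial standard `L`-function of a cuspidal `Π` of `GL_n(𝔸_K)` (finite `S`, honest Satake family) is
non-zero — Jacquet–Shalika (1976), Theorem: "`L_S(1 + it, π) ≠ 0`". Then for every cuspidal `Π`, every
finite `S` and every Satake family `γ` of `Π` off `S`, `L^S(s, Π) → c ≠ 0` as `s → s₀`, `Re s > 1`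
(the proof of `standard_at_one_of_godementJacquet_of_nonvanishing` at `s₀`; Jacquet–Shalika's (5.3.3)
and (5.1.3) are the theorems `summable_normSq_trace_satakePow_holds`, `norm_satakeParameter_le_sqrt_holds`).
[cite: GodementJacquet1972, Thm. 13.8] [cite: JacquetShalikaInvent1976, Theorem p. 1] -/
theorem standard_at_of_godementJacquet_of_nonvanishing (hn : 2 ≤ n)
    (hGJ : godementJacquet (n := n) (K := K) (μ := μ)) {s₀ : ℂ} (hs₀ : s₀.re = 1)
    (hNV : ∀ (Q : CuspidalAutomorphicRepGL n K μ) {S : Set (HeightOneSpectrum (𝓞 K))}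
      (_hS : S.Finite) {γ : SatakeFamily K} (_hγ : IsSatakeFamilyOf Q S γ) {c : ℂ},
      Tendsto (partialStandardL S γ) (𝓝[{s : ℂ | 1 < s.re}] s₀) (𝓝 c) → c ≠ 0)
    (Q : CuspidalAutomorphicRepGL n K μ) {S : Set (HeightOneSpectrum (𝓞 K))} (hS : S.Finite)
    {γ : SatakeFamily K} (hγ : IsSatakeFamilyOf Q S γ) :
    ∃ c : ℂ, c ≠ 0 ∧ Tendsto (partialStandardL S γ) (𝓝[{s : ℂ | 1 < s.re}] s₀) (𝓝 c) := by
  have h₂ := summable_normSq_trace_satakePow_holds (n := n) (K := K) (μ := μ)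
  obtain ⟨D, hD, -⟩ := hGJ Q (Or.inl hn)
  obtain ⟨c₀, hc₀⟩ := D.exists_tendsto_partialStandardL_of_hasEntireContinuation h₂ hD
    (s₀ := s₀) hs₀.le
  have hc₀ne : c₀ ≠ 0 := hNV Q D.S.finite_toSet D.isSatakeFamily hc₀
  -- the common set `B = D.S ∪ S`
  set B : Set (HeightOneSpectrum (𝓞 K)) := ↑D.S ∪ S with hB
  have hBfin : B.Finite := D.S.finite_toSet.union hS
  have hαB : IsSatakeFamilyOf Q B D.α := D.isSatakeFamily.mono Set.subset_union_left
  have hγB : IsSatakeFamilyOf Q B γ := hγ.mono Set.subset_union_right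
  -- non-vanishing of unramified factors at `s₀`, from (5.1.3)
  have hne : ∀ {T : Set (HeightOneSpectrum (𝓞 K))} {δ : SatakeFamily K} (_hδ : IsSatakeFamilyOf Q T δ)
      {v : HeightOneSpectrum (𝓞 K)} (_hv : v ∉ T),
      (eulerPolynomial (δ v)).eval ((v.residueCard : ℂ) ^ (-s₀)) ≠ 0 :=
    fun hδ v hv => eval_eulerPolynomial_ne_zero_of_sqrt v.one_lt_residueCard
      (fun a ha => norm_satakeParameter_le_sqrt_holds Q hδ hv ha)
      (by rw [hs₀]; norm_num)
  -- multipliability off `B` on `Re s > 1`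
  have hmul : ∀ {δ : SatakeFamily K} (_hδ : IsSatakeFamilyOf Q B δ),
      ∀ᶠ s in 𝓝[{s : ℂ | 1 < s.re}] s₀,
        Multipliable fun v : {v : HeightOneSpectrum (𝓞 K) // v ∉ B} =>
          ((eulerPolynomial (δ v.1)).eval ((v.1.residueCard : ℂ) ^ (-s)))⁻¹ :=
    fun hδ => eventually_nhdsWithin_of_forall fun s hs =>
      multipliable_partialStandardL_of_summable h₂ Q hδ hs
  -- up from `D.S` to `B` with the family `D.α`
  have h1 : ∃ c : ℂ, c ≠ 0 ∧ Tendsto (partialStandardL B D.α) (𝓝[{s : ℂ | 1 < s.re}] s₀) (𝓝 c) :=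
    exists_ne_zero_tendsto_partialStandardL_of_supset Set.subset_union_left
      (hBfin.subset fun v hv => hv.1) (hmul hαB) (fun v hv => hne D.isSatakeFamily hv.2)
      ⟨c₀, hc₀ne, hc₀⟩
  -- `L^B(D.α) = L^B(γ)`
  rw [partialStandardL_eq_of_isSatakeFamilyOf Set.subset_union_left Set.subset_union_right
    D.isSatakeFamily hγ] at h1
  -- down from `B` to `S` with the family `γ`
  exact exists_ne_zero_tendsto_partialStandardL_of_subset Set.subset_union_right
    (hBfin.subset fun v hv => hv.1) (hmul hγB) (fun v hv => hne hγ hv.2) h1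

end StandardStatement

/-! ### The `GL_n × GL_1` datum at a point of the line from the standard statement -/

section Datum

variable {n : ℕ} {K : Type} [Field K] [NumberField K]
  {μ : Measure (gl n K).automorphicQuotient} [(gl n K).IsAutomorphicMeasure μ]
  {μ₁ : Measure (gl 1 K).automorphicQuotient} [(gl 1 K).IsAutomorphicMeasure μ₁]

/-- **The one-family datum for `GL_n × GL_1` at `s₀` from the standard statement at `s₀`** (the
proof of `exists_one_family_datum_of_standard` at a general point: Satake families of `π` and `χ`, a
level `𝔪` of `χ`, `S₀` the union of the exceptional sets and the support of `𝔪`, and the standard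
statement for the twist `π ⊗ χ`, whose partial standard `L`-function off `S₀` is `L^{S₀}(s, α₀ ⊗ β₀)`).
[cite: ArthurClozelAMS120, Ch. 3 §2 (2.2) and p. 172] -/
theorem exists_one_family_datum_of_standard_at {s₀ : ℂ}
    (hstd : ∀ (Q : CuspidalAutomorphicRepGL n K μ) {S : Set (HeightOneSpectrum (𝓞 K))}
      (_hS : S.Finite) {γ : SatakeFamily K} (_hγ : IsSatakeFamilyOf Q S γ),
      ∃ c : ℂ, c ≠ 0 ∧ Tendsto (partialStandardL S γ) (𝓝[{s : ℂ | 1 < s.re}] s₀) (𝓝 c))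
    (P : CuspidalAutomorphicRepGL n K μ) (P' : CuspidalAutomorphicRepGL 1 K μ₁) :
    ∃ (S₀ : Set (HeightOneSpectrum (𝓞 K))) (α₀ β₀ : SatakeFamily K), S₀.Finite ∧
      IsSatakeFamilyOf P S₀ α₀ ∧ IsSatakeFamilyOf P' S₀ β₀ ∧
      ∃ c : ℂ, c ≠ 0 ∧ Tendsto (partialPairL S₀ α₀ β₀) (𝓝[{s : ℂ | 1 < s.re}] s₀) (𝓝 c) := by
  classical
  obtain ⟨S₁, α, -, hα⟩ := exists_isSatakeFamilyOf_holds (n := n) (K := K) (μ := μ) P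
  obtain ⟨S₂, β, -, hβ⟩ := exists_isSatakeFamilyOf_holds (n := 1) (K := K) (μ := μ₁) P'
  obtain ⟨𝔪, h𝔪, hχ𝔪⟩ := P'.heckeCharacter.exists_level n
  have hT : {v : HeightOneSpectrum (𝓞 K) | v.asIdeal ∣ 𝔪}.Finite := Ideal.finite_factors h𝔪
  set S₀ : Set (HeightOneSpectrum (𝓞 K)) :=
    (↑S₁ ∪ ↑S₂) ∪ {v : HeightOneSpectrum (𝓞 K) | v.asIdeal ∣ 𝔪} with hS₀_def
  have hS₀ : S₀.Finite := (S₁.finite_toSet.union S₂.finite_toSet).union hT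
  have hα₀ : IsSatakeFamilyOf P S₀ α :=
    hα.mono (Set.subset_union_left.trans Set.subset_union_left)
  have hβ₀ : IsSatakeFamilyOf P' S₀ β :=
    hβ.mono (Set.subset_union_right.trans Set.subset_union_left)
  -- the twist `π ⊗ χ` and its Satake family `χ(ϖ_v) α(v)` off `S₀`
  have hγ := hα₀.twistByChar P'.heckeCharacter P'.isUnitary_heckeCharacter
    P'.heckeCharacter_posRealIdele h𝔪 hχ𝔪 (fun v hv hdvd => hv (Set.mem_union_right _ hdvd))
  obtain ⟨c, hc, hlim⟩ := hstd _ hS₀ hγ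
  refine ⟨S₀, α, β, hS₀, hα₀, hβ₀, c, hc, ?_⟩
  rwa [partialPairL_eq_partialStandardL_twist hβ₀ α]

/-- The same datum for the pair in the other order, `(χ, π)` (`partialPairL_comm`).
[cite: ArthurClozelAMS120, Ch. 3 §2 (2.2)] -/
theorem exists_one_family_datum_of_standard_at_left {s₀ : ℂ}
    (hstd : ∀ (Q : CuspidalAutomorphicRepGL n K μ) {S : Set (HeightOneSpectrum (𝓞 K))}
      (_hS : S.Finite) {γ : SatakeFamily K} (_hγ : IsSatakeFamilyOf Q S γ),
      ∃ c : ℂ, c ≠ 0 ∧ Tendsto (partialStandardL S γ) (𝓝[{s : ℂ | 1 < s.re}] s₀) (𝓝 c))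
    (P' : CuspidalAutomorphicRepGL 1 K μ₁) (P : CuspidalAutomorphicRepGL n K μ) :
    ∃ (S₀ : Set (HeightOneSpectrum (𝓞 K))) (β₀ α₀ : SatakeFamily K), S₀.Finite ∧
      IsSatakeFamilyOf P' S₀ β₀ ∧ IsSatakeFamilyOf P S₀ α₀ ∧
      ∃ c : ℂ, c ≠ 0 ∧ Tendsto (partialPairL S₀ β₀ α₀) (𝓝[{s : ℂ | 1 < s.re}] s₀) (𝓝 c) := by
  obtain ⟨S₀, α₀, β₀, hS₀, hα₀, hβ₀, c, hc, hlim⟩ := exists_one_family_datum_of_standard_at hstd P P'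
  exact ⟨S₀, β₀, α₀, hS₀, hβ₀, hα₀, c, hc, by rwa [partialPairL_comm S₀ β₀ α₀]⟩

end Datum

/-! ### (2.2) off `s = 1` for `GL_n × GL_1` and `GL_1 × GL_n` -/

section RankOne

variable {n : ℕ} {K : Type} [Field K] [NumberField K]
  {μ : Measure (gl n K).automorphicQuotient} [(gl n K).IsAutomorphicMeasure μ]
  {μ₁ : Measure (gl 1 K).automorphicQuotient} [(gl 1 K).IsAutomorphicMeasure μ₁]

/-- **Arthur–Clozel (2.2) off `s = 1` for `GL_n × GL_1` (`n ≥ 2`) from Godement–Jacquet at `GL_n` and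
the non-vanishing on the line.** The named fact `JacquetShalika1981_partialPairL_boundary_of_ne_one` for
`(n, m) = (n, 1)` follows from the named fact `godementJacquet` at `GL_n` (Godement–Jacquet (1972),
Thm. 13.8: `L(s, Π)` entire) and the non-vanishing of the boundary values of the partial standard
`L`-functions of cuspidal representations of `GL_n(𝔸_K)` at the points `s₀ ≠ 1` of `re s = 1`
(Jacquet–Shalika (1976), Theorem: `L_S(1 + it, Π) ≠ 0`): the datum of
`exists_one_family_datum_of_standard_at` into the one-family reduction
`JacquetShalika1981_partialPairL_boundary_of_ne_one_of_one_family_of_le_two'` (strict bound at `GL_1`,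
a theorem). Every other input of the printed proof is a theorem of the tree.
[cite: ArthurClozelAMS120, Ch. 3 §2 (2.2)] [cite: GodementJacquet1972, Thm. 13.8]
[cite: JacquetShalikaInvent1976, Theorem p. 1] -/
theorem JacquetShalika1981_partialPairL_boundary_of_ne_one_of_godementJacquet_of_nonvanishing
    (hn : 2 ≤ n) (hGJ : godementJacquet (n := n) (K := K) (μ := μ))
    (hNV : ∀ {s₀ : ℂ} (_hs₀ : s₀.re = 1) (_hs₁ : s₀ ≠ 1) (Q : CuspidalAutomorphicRepGL n K μ)
      {S : Set (HeightOneSpectrum (𝓞 K))} (_hS : S.Finite) {γ : SatakeFamily K}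
      (_hγ : IsSatakeFamilyOf Q S γ) {c : ℂ},
      Tendsto (partialStandardL S γ) (𝓝[{s : ℂ | 1 < s.re}] s₀) (𝓝 c) → c ≠ 0) :
    JacquetShalika1981_partialPairL_boundary_of_ne_one (n := n) (m := 1) (K := K) (μ := μ)
      (μ' := μ₁) :=
  JacquetShalika1981_partialPairL_boundary_of_ne_one_of_one_family_of_le_two' (by norm_num)
    fun _ _ P P' _ hs₀ hs₁ => exists_one_family_datum_of_standard_at
      (standard_at_of_godementJacquet_of_nonvanishing hn hGJ hs₀ (hNV hs₀ hs₁)) P P'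

/-- **Arthur–Clozel (2.2) off `s = 1` for `GL_1 × GL_n` (`n ≥ 2`)**, symmetrically
(`JacquetShalika1981_partialPairL_boundary_of_ne_one_of_one_family_of_le_two` with the datum
`exists_one_family_datum_of_standard_at_left`). [cite: ArthurClozelAMS120, Ch. 3 §2 (2.2)]
[cite: GodementJacquet1972, Thm. 13.8] [cite: JacquetShalikaInvent1976, Theorem p. 1] -/
theorem JacquetShalika1981_partialPairL_boundary_of_ne_one_of_godementJacquet_of_nonvanishing_left
    (hn : 2 ≤ n) (hGJ : godementJacquet (n := n) (K := K) (μ := μ))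
    (hNV : ∀ {s₀ : ℂ} (_hs₀ : s₀.re = 1) (_hs₁ : s₀ ≠ 1) (Q : CuspidalAutomorphicRepGL n K μ)
      {S : Set (HeightOneSpectrum (𝓞 K))} (_hS : S.Finite) {γ : SatakeFamily K}
      (_hγ : IsSatakeFamilyOf Q S γ) {c : ℂ},
      Tendsto (partialStandardL S γ) (𝓝[{s : ℂ | 1 < s.re}] s₀) (𝓝 c) → c ≠ 0) :
    JacquetShalika1981_partialPairL_boundary_of_ne_one (n := 1) (m := n) (K := K) (μ := μ₁)
      (μ' := μ) :=
  JacquetShalika1981_partialPairL_boundary_of_ne_one_of_one_family_of_le_two (by norm_num)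
    fun _ _ P' P _ hs₀ hs₁ => exists_one_family_datum_of_standard_at_left
      (standard_at_of_godementJacquet_of_nonvanishing hn hGJ hs₀ (hNV hs₀ hs₁)) P' P

end RankOne

end Literature.NumberTheory.Automorphic
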